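import Mathlib.NumberTheory.Transcendental.Lindemann.AnalyticalPart
import Mathlib.RingTheory.AlgebraicIndependent.Basic
import Mathlib.RingTheory.Algebraic.Integral
import Mathlib.FieldTheory.IntermediateField.Algebraic
import Mathlib.FieldTheory.AlgebraicClosure
import Mathlib.Analysis.SpecialFunctions.Complex.Log
import HarnessLib

-- provenance: harness21/H21/H21/Prelude/TranscendKaehlerL/LindemannWeierstrass.lean @ 99cb807 (interim HEAD d8f2665); M5 mechanical rewrite
/-!
# The Lindemann–Weierstrass theorem (statement layer)

Trunk `TranscendKaehlerL`, notion `lindemann_weierstrass_theorem` (family `periods`).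

This prelude file states the full Lindemann–Weierstrass theorem in three classical shapes and
records their (elementary) equivalences, so that the tagged Wave0 statements
`Literature.NumberTheory.Transcendental.algebraicIndependent_exp` / `linearIndependent_exp` (periods.S10) and the
Hermite–Lindemann corollaries (periods.S11) can later be discharged from *one* upstream lemma.
No inventory ids are carried here (they live in `H21/Statements/Periods/Wave0.lean`, which is
deliberately not imported).

* `SumForm` — the shape of mathlib4 PR #6718 (Baker 1975, Theorem 1.4, "sum form"): if
  `α₁, …, αₙ` are distinct algebraic numbers and `a₁, …, aₙ` are algebraic numbers with
  `∑ aᵢ e^{αᵢ} = 0`, then all `aᵢ = 0`. Indexed by a `Finset ℂ` and a coefficient function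
  `a : ℂ → ℂ`.
* `LinIndep` — Baker's reformulation: for distinct algebraic `αᵢ`, the `e^{αᵢ}` are linearly
  independent over the field `ℚ̄ = algebraicClosure ℚ ℂ` of algebraic numbers.
* `AlgIndep` — Weierstrass' original form: for algebraic `αᵢ` linearly independent over `ℚ`,
  the `e^{αᵢ}` are algebraically independent over `ℚ`.

`LinIndep` and `AlgIndep` are stated for `Fin n`-indexed families (finitary, hence
universe-free `Prop`s); the reduction lemmas `LinIndep.linearIndependent` and
`AlgIndep.algebraicIndependent` recover the arbitrary-index-type shapes used in Wave0, via
`linearIndependent_iff_finset_linearIndependent` and `algebraicIndependent_of_finite_type`.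

Main results:
* `sumForm : SumForm` — the theorem itself (`sorry`; the upstream target, only the analytic
  part `LindemannWeierstrass.exp_polynomial_approx` being in Mathlib);
* `SumForm.sum_ne_zero`, `sum_ne_zero` — indexed `Finset ι` variant, *proved* from the sum form;
* `linIndep_of_sumForm`, `sumForm_iff_linIndep` (*proved*), `linIndep_iff_algIndep` (`sorry`;
  Baker 1975, proof of Theorem 1.4);
* `transcendental_exp_of_sumForm`, `transcendental_pi_of_sumForm`,
  `transcendental_exp_one_of_sumForm` — the Hermite–Lindemann corollaries, *proved* from the
  sum form.

Mathlib search: Mathlib has `IsAlgebraic`, `Transcendental`, `AlgebraicIndependent`,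
`LinearIndependent`, `algebraicClosure`, `Complex.exp` and the namespace `LindemannWeierstrass`
(analytic part only); it has no statement of the full theorem, of Hermite–Lindemann, or of the
transcendence of `e` / `π` (checked by grep, Mathlib tag v4.32.0).

All declarations live in `namespace Literature.LindemannWeierstrass` (not Mathlib's root namespace
`LindemannWeierstrass`).

References: A. Baker, *Transcendental Number Theory* (1975), Theorems 1.2–1.4;
K. Weierstrass (1885); F. Lindemann (1882); C. Hermite (1873); mathlib4 PR #6718.
-/

noncomputable section

open Complex Finset

namespace Literature.NumberTheory.Transcendental.LindemannWeierstrass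

/-! ### The three shapes -/

/-- The Lindemann–Weierstrass theorem, **sum form** (Baker 1975, Theorem 1.4; shape of
mathlib4 PR #6718): for every finite set `s` of algebraic complex numbers and every
algebraic-valued coefficient function `a`, if `∑_{x ∈ s} a x · e^x = 0` then `a x = 0` for all
`x ∈ s`. [cite: Baker1975, Theorem 1.4] -/
def SumForm : Prop :=
  ∀ (s : Finset ℂ) (a : ℂ → ℂ), (∀ x ∈ s, IsAlgebraic ℚ x) → (∀ x ∈ s, IsAlgebraic ℚ (a x)) →
    ∑ x ∈ s, a x * cexp x = 0 → ∀ x ∈ s, a x = 0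

/-- The Lindemann–Weierstrass theorem, **Baker's reformulation** (Baker 1975, Theorem 1.4):
if `α₀, …, αₙ₋₁` are pairwise distinct algebraic numbers then `e^{α₀}, …, e^{αₙ₋₁}` are
linearly independent over the field `ℚ̄ = algebraicClosure ℚ ℂ` of algebraic numbers.
Finitary (`Fin n`-indexed); see `LinIndep.linearIndependent` for arbitrary index types. [cite: Baker1975, Theorem 1.4] -/
def LinIndep : Prop :=
  ∀ (n : ℕ) (α : Fin n → ℂ), (∀ i, IsAlgebraic ℚ (α i)) → Function.Injective α →
    LinearIndependent (algebraicClosure ℚ ℂ) (cexp ∘ α)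

/-- The Lindemann–Weierstrass theorem, **Weierstrass' form** (Weierstrass 1885; Baker 1975,
Theorem 1.4): if `α₀, …, αₙ₋₁` are algebraic numbers linearly independent over `ℚ` then
`e^{α₀}, …, e^{αₙ₋₁}` are algebraically independent over `ℚ`.
Finitary (`Fin n`-indexed); see `AlgIndep.algebraicIndependent` for arbitrary index types. [cite: Weierstrass1885] -/
def AlgIndep : Prop :=
  ∀ (n : ℕ) (α : Fin n → ℂ), (∀ i, IsAlgebraic ℚ (α i)) → LinearIndependent ℚ α →
    AlgebraicIndependent ℚ (cexp ∘ α)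

/-! ### Reduction to arbitrary index types -/

/-- Baker's reformulation for an arbitrary index type: if `LinIndep` holds and `α : ι → ℂ` is an
injective family of algebraic numbers, then `cexp ∘ α` is linearly independent over `ℚ̄`
(the shape of `Literature.NumberTheory.Transcendental.linearIndependent_exp`, periods.S10). Proved by reduction to finite
subfamilies (`linearIndependent_iff_finset_linearIndependent`). [folklore] -/
theorem LinIndep.linearIndependent (h : LinIndep) {ι : Type*} (α : ι → ℂ)
    (halg : ∀ i, IsAlgebraic ℚ (α i)) (hinj : Function.Injective α) :
    LinearIndependent (algebraicClosure ℚ ℂ) (cexp ∘ α) := by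
  rw [linearIndependent_iff_finset_linearIndependent]
  intro s
  rw [← linearIndependent_equiv s.equivFin.symm]
  exact h _ (α ∘ Subtype.val ∘ s.equivFin.symm) (fun i => halg _)
    (hinj.comp (Subtype.val_injective.comp s.equivFin.symm.injective))

/-- Weierstrass' form for an arbitrary index type: if `AlgIndep` holds and `α : ι → ℂ` is a
`ℚ`-linearly independent family of algebraic numbers, then `cexp ∘ α` is algebraically
independent over `ℚ` (the shape of `Literature.NumberTheory.Transcendental.algebraicIndependent_exp`, periods.S10).
Proved by reduction to finite subfamilies (`algebraicIndependent_of_finite_type`). [folklore] -/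
theorem AlgIndep.algebraicIndependent (h : AlgIndep) {ι : Type*} (α : ι → ℂ)
    (halg : ∀ i, IsAlgebraic ℚ (α i)) (hli : LinearIndependent ℚ α) :
    AlgebraicIndependent ℚ (cexp ∘ α) := by
  refine algebraicIndependent_of_finite_type fun t ht => ?_
  haveI : Fintype t := ht.fintype
  rw [← algebraicIndependent_equiv (Fintype.equivFin t).symm]
  exact h _ (α ∘ Subtype.val ∘ (Fintype.equivFin t).symm) (fun i => halg _)
    (hli.comp _ (Subtype.val_injective.comp (Fintype.equivFin t).symm.injective))

/-! ### The theorem and its indexed variant -/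

/-- **The Lindemann–Weierstrass theorem** (sum form; Baker 1975, Theorem 1.4; Weierstrass
1885). Known theorem, not in Mathlib (only the analytic part
`LindemannWeierstrass.exp_polynomial_approx` is); upstream target: mathlib4 PR #6718. [cite: Baker1975, Theorem 1.4] -/
def sumForm : Prop :=
  SumForm

/-- Indexed sum form from the hypothesis `SumForm`: if `α` is injective on a finite set `s` of
indices, the `α i` and the coefficients `a i` (`i ∈ s`) are algebraic and some `a i ≠ 0`, then
`∑_{i ∈ s} a i · e^{α i} ≠ 0` (Baker 1975, Theorem 1.4). The reindexing step behind
`sum_ne_zero` and the Hermite–Lindemann corollaries below. [cite: Baker1975, Theorem 1.4] -/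
theorem SumForm.sum_ne_zero (h : SumForm) {ι : Type*} (s : Finset ι) (α a : ι → ℂ)
    (halg : ∀ i ∈ s, IsAlgebraic ℚ (α i)) (ha : ∀ i ∈ s, IsAlgebraic ℚ (a i))
    (hinj : Set.InjOn α s) (hne : ∃ i ∈ s, a i ≠ 0) :
    ∑ i ∈ s, a i * cexp (α i) ≠ 0 := by
  classical
  obtain ⟨i₀, hi₀, hai₀⟩ := hne
  haveI : Nonempty ι := ⟨i₀⟩
  intro hsum
  have hleft : ∀ i ∈ s, Function.invFunOn α s (α i) = i := fun i hi =>
    hinj.leftInvOn_invFunOn hi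
  refine hai₀ ?_
  have key := h (s.image α) (a ∘ Function.invFunOn α s) ?_ ?_ ?_ (α i₀)
    (mem_image_of_mem α hi₀)
  · simpa [hleft i₀ hi₀] using key
  · rintro x hx
    obtain ⟨i, hi, rfl⟩ := mem_image.1 hx
    exact halg i hi
  · rintro x hx
    obtain ⟨i, hi, rfl⟩ := mem_image.1 hx
    simpa [hleft i hi] using ha i hi
  · rw [sum_image hinj, ← hsum]
    exact sum_congr rfl fun i hi => by simp [hleft i hi]

/-- The Lindemann–Weierstrass theorem, indexed sum form: if `α` is injective on a finite set
`s` of indices, the `α i` and the coefficients `a i` (`i ∈ s`) are algebraic and some `a i ≠ 0`,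
then `∑_{i ∈ s} a i · e^{α i} ≠ 0` (Baker 1975, Theorem 1.4). Derived from `sumForm`. [cite: Baker1975, Theorem 1.4] -/
def sum_ne_zero : Prop :=
  ∀ {ι : Type*} (s : Finset ι) (α a : ι → ℂ) (halg : ∀ i ∈ s, IsAlgebraic ℚ (α i)) (ha : ∀ i ∈ s, IsAlgebraic ℚ (a i)) (hinj : Set.InjOn α s) (hne : ∃ i ∈ s, a i ≠ 0),
    ∑ i ∈ s, a i * cexp (α i) ≠ 0

/- interim proof relied on results that are now named facts (D-0014); demoted to a fact by the M5 import, proof preserved: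
:=
  sumForm.sum_ne_zero s α a halg ha hinj hne
-/

/-! ### Equivalence of the three shapes -/

/-- The sum form implies Baker's reformulation (Baker 1975, Theorem 1.4, remark following the
statement): a vanishing `ℚ̄`-linear combination `∑ cᵢ e^{αᵢ} = 0` is a relation of the sum form
with algebraic coefficients. [cite: Baker1975, Theorem 1.4  remark following the statem] -/
theorem linIndep_of_sumForm (h : SumForm) : LinIndep := by
  intro n α halg hinj
  rw [Fintype.linearIndependent_iff]
  intro g hg i
  by_contra hgi
  refine h.sum_ne_zero univ α (fun i => ((g i : ℂ))) (fun i _ => halg i)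
    (fun i _ => mem_algebraicClosure_iff.mp (g i).2) hinj.injOn
    ⟨i, mem_univ _, fun h0 => hgi (Subtype.ext h0)⟩ ?_
  simpa [IntermediateField.smul_def] using hg

/-- The sum form is equivalent to Baker's reformulation (Baker 1975, Theorem 1.4). The forward
direction is `linIndep_of_sumForm`; the converse restricts a sum-form relation to the finite
set `s ≃ Fin s.card`. [cite: Baker1975, Theorem 1.4] -/
theorem sumForm_iff_linIndep : SumForm ↔ LinIndep := by
  refine ⟨linIndep_of_sumForm, fun h s a halg ha hsum x hx => ?_⟩
  set e := s.equivFin.symm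
  set α : Fin s.card → ℂ := Subtype.val ∘ e
  have hli := h s.card α (fun i => halg _ (e i).2)
    (Subtype.val_injective.comp e.injective)
  rw [Fintype.linearIndependent_iff] at hli
  let g : Fin s.card → algebraicClosure ℚ ℂ :=
    fun i => ⟨a (α i), mem_algebraicClosure_iff.mpr (ha _ (e i).2)⟩
  have hg : ∑ i, g i • (cexp ∘ α) i = 0 := by
    have : ∑ i, g i • (cexp ∘ α) i = ∑ y : s, a y * cexp y := by
      simp only [IntermediateField.smul_def, Function.comp_apply, g, α, smul_eq_mul]
      exact e.sum_comp (fun y : s => a y * cexp y)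
    rw [this, Finset.sum_coe_sort s (fun y => a y * cexp y), hsum]
  have := hli g hg (e.symm ⟨x, hx⟩)
  simpa [g, α] using congrArg Subtype.val this

/-- Baker's reformulation is equivalent to Weierstrass' form (Baker 1975, Theorem 1.4 and the
paragraph following it: expand a polynomial relation among the `e^{αᵢ}` into a linear one among
`e^{⟨k, α⟩}` with distinct exponents, and conversely). [cite: Baker1975, Theorem 1.4 and the paragraph following] -/
def linIndep_iff_algIndep : Prop :=
  LinIndep ↔ AlgIndep

/-! ### Hermite–Lindemann corollaries -/

/-- **Hermite–Lindemann** from the sum form (Lindemann 1882; Baker 1975, Theorem 1.2): if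
`α ≠ 0` is algebraic then `e^α` is transcendental. Proof: a polynomial relation
`∑ cₖ (e^α)^k = 0` is the sum-form relation `∑ cₖ e^{kα} = 0` with distinct exponents `kα`. [cite: Lindemann1882] -/
theorem transcendental_exp_of_sumForm (h : SumForm) {α : ℂ} (hα : IsAlgebraic ℚ α)
    (h0 : α ≠ 0) : Transcendental ℚ (cexp α) := by
  rintro ⟨p, hp0, hp⟩
  rw [Polynomial.aeval_eq_sum_range] at hp
  refine h.sum_ne_zero (range (p.natDegree + 1)) (fun k : ℕ => (k : ℂ) * α)
    (fun k => algebraMap ℚ ℂ (p.coeff k)) (fun k _ => (isAlgebraic_nat k).mul hα)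
    (fun k _ => isAlgebraic_algebraMap _) ?_ ⟨p.natDegree, by simp, ?_⟩ ?_
  · intro i _ j _ hij
    exact_mod_cast mul_right_cancel₀ h0 hij
  · simpa using hp0
  · rw [← hp]
    refine sum_congr rfl fun k _ => ?_
    rw [Algebra.smul_def, Complex.exp_nat_mul]

/-- **Transcendence of `π`** from the sum form (Lindemann 1882; Baker 1975, Theorem 1.3):
Euler's identity `e^0 + e^{iπ} = 0` would be a sum-form relation with nonzero algebraic
coefficients if `π` (hence `iπ`) were algebraic. [cite: Lindemann1882] -/
theorem transcendental_pi_of_sumForm (h : SumForm) : Transcendental ℚ Real.pi := by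
  intro hpi
  have hpiC : IsAlgebraic ℚ (Real.pi : ℂ) :=
    (isAlgebraic_algebraMap_iff (A := ℂ) Complex.ofReal_injective).mpr hpi
  have hI : IsAlgebraic ℚ Complex.I := by
    refine ⟨Polynomial.X ^ 2 + 1, Polynomial.Monic.ne_zero (by monicity!), ?_⟩
    simp
  have hne : (0 : ℂ) ≠ Real.pi * Complex.I := by
    simp [Real.pi_ne_zero, Complex.I_ne_zero]
  refine h.sum_ne_zero ({0, (Real.pi : ℂ) * Complex.I} : Finset ℂ) id (fun _ => 1) ?_
    (fun _ _ => isAlgebraic_one) (Set.injOn_id _) ⟨0, by simp, one_ne_zero⟩ ?_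
  · intro x hx
    simp only [mem_insert, mem_singleton] at hx
    rcases hx with rfl | rfl
    · exact isAlgebraic_zero
    · exact hpiC.mul hI
  · rw [sum_pair hne]
    simp [Complex.exp_pi_mul_I]

/-- **Transcendence of `e`** from the sum form (Hermite 1873; Baker 1975, Theorem 1.2 with
`α = 1`). [cite: Hermite1873] -/
theorem transcendental_exp_one_of_sumForm (h : SumForm) : Transcendental ℚ (Real.exp 1) := by
  have := transcendental_exp_of_sumForm h (α := 1) isAlgebraic_one one_ne_zero
  rw [show cexp 1 = ((Real.exp 1 : ℝ) : ℂ) by simp [Complex.ofReal_exp]] at this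
  exact (transcendental_algebraMap_iff (A := ℂ) Complex.ofReal_injective).mp this

end Literature.NumberTheory.Transcendental.LindemannWeierstrass
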